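import Summits.Ventures.CertifiedManyBodySolver.Theorems.M3x2EdgeSplitSymReplayGramRDecodeV2
import Summits.Ventures.CertifiedManyBodySolver.Theorems.M3x2EdgeSplitSymReplayOutRouteMFD
import HarnessLib

/-!
# SymReplay checker — the β/β⁺ SIDE FACTS `liftOKR` / `denseOKR` ARE THEOREMS OF THE TRANSPORT GRAMMAR

(team lb-sym, cell hub-lb; text by the team referee hub-lb-sym-ref-2 g2 (pub `hub-lb-sym-ref-2/g2/lean/SideFactsByGrammar.lean`
d61924fffad709aa), landed verbatim by hub-lb-sym-eng-4 g3 on the referee's word (STATUS l.2182/l.2204) with docstrings added;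
ADDITIVE on `…GramRDecode` / `…GramRDecodeV2` / `…OutRouteMFZ` (p663389) / `…OutRouteMFD` (p665356); nothing landed is touched.)

WHY.  The integer-dot enumerators close through `energyDensity_ge_of_outroutePMFZ0` / `…PMFD0` under two GLOBAL side facts
`hZ : liftOKR K = true` (every R-block's rows lift back from their integerisation) and `hD : denseOKR K = true` (every
integerised row has strictly ascending columns below the block width), each planned as one `native_decide` per certificate —
an evaluation over the whole `gramR` text (at E₁: 85 → O(10³) blocks, 10⁵ → 10⁷ entries).  Both are CONSEQUENCES OF THE GRAMMAR:
`rdEntries … l :: k :: ts => (((l : ℚ), k.toNat) …` (v1) and `rdEntriesD … l :: d :: ts => … (((l : ℚ), k) …`, `k = nxt + d.toNat`,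
recursing at `k + 1` (v2) read every factor-row entry as an INTEGER cast into `ℚ`, and v2 builds the columns by a delta code, hence
STRICTLY ASCENDING by construction.  Integer rows have `rowsDen = 1`, `rowZ 1` = numerators, `liftRow 1 ∘ rowZ 1 = id`, so
`liftOK 1` and `liftOKR` hold; ascending columns give `colsAscLt`, and the width half of `rowOKZ` holds for ANY block because
`blockWidth` is one more than the largest column.  RESULT: for every token list, with NO evaluation,
`liftOKR (decodeSymCertR ts tsR) = true`, `liftOKR (decodeSymCertRV2 ts tsR) = true` (v1 R-text), and
`liftOKR (decodeSymCertRV2V2 ts tsR) = true ∧ denseOKR (decodeSymCertRV2V2 ts tsR) = true` (v2 R-text); the closing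
`energyDensity_ge_of_outroutePMFD0_gramRV2` below carries NEITHER side fact as a hypothesis.  (For a v1 R-text `denseOKR`
remains a property of the data — the columns are literal; rung V has it: columns strictly ascending in all 85 blocks.)

CONTENTS.  `IntRows`; grammar lemmas `decodeGramR_int`, `decodeGramRV2_int`, `decodeGramRV2_sorted` (with their `rd…` layers);
`rowsDen_eq_one`, `liftRow_rowZ_one`, `liftOK_one`, **`liftOKR_of_intRows`**; `colsAscLt_of_pairwise`, `lt_blockWidth`,
**`denseOKR_of_sorted`**; instances `liftOKR_decodeGramR/…SymCertR/…SymCertRV2/…GramRV2/…SymCertRV2V2`,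
`denseOKR_decodeGramRV2/…SymCertRV2V2`; closing corollary `energyDensity_ge_of_outroutePMFD0_gramRV2`.  Standard axioms; no
`native_decide`, no `decide` on data; every proof is structural induction on the decoder.

HONEST FRAMING: proof plumbing that removes two per-certificate evaluations; certifies nothing; no certificate lands by this file; no
bound of record moves (#529 −0.8295699476 outside Lean; tree floor −0.8942613047 computational; stmt-Ventures-22024 met BY VALUE only,
un-landed; stmt-Ventures-21721 open); no summit or crux statement is proved here; nothing here predicts superconductivity.
-/

namespace Summit.Ventures.CertifiedManyBodySolver.Theorems.SymReplay

section SideFacts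

/-- Every entry of every row is an integer cast into `ℚ`. -/
def IntRows (rows : List (List (ℚ × ℕ))) : Prop := ∀ r ∈ rows, ∀ e ∈ r, ∃ z : ℤ, e.1 = (z : ℚ)

/-! ### grammar v1 (`…Decode.rdEntries/rdRows`, `…GramRDecode.rdRBlock/rdRBlocks/decodeGramR`): integer entries -/

/-- v1 grammar: every entry read by `rdEntries` is an integer cast into `ℚ`. -/
theorem rdEntries_int : ∀ (n : ℕ) (ts : Toks) (e : ℚ × ℕ), e ∈ (rdEntries n ts).1 → ∃ z : ℤ, e.1 = (z : ℚ)
  | 0, ts, e, he => by simp [rdEntries] at he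
  | _ + 1, [], e, he => by simp [rdEntries] at he
  | _ + 1, [_], e, he => by simp [rdEntries] at he
  | n + 1, l :: k :: ts, e, he => by
    simp only [rdEntries, List.mem_cons] at he
    rcases he with rfl | he
    · exact ⟨l, rfl⟩
    · exact rdEntries_int n ts e he

/-- v1 grammar: `rdRows` reads integer rows. -/
theorem rdRows_int : ∀ (n : ℕ) (ts : Toks), IntRows (rdRows n ts).1
  | 0, ts => by simp [rdRows, IntRows]
  | n + 1, ts => by
    intro r hr
    simp only [rdRows, List.mem_cons] at hr
    rcases hr with rfl | hr
    · exact rdEntries_int _ _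
    · exact rdRows_int n _ r hr

/-- v1 grammar: `rdRBlock` reads a block with integer rows. -/
theorem rdRBlock_int (ts : Toks) : IntRows (rdRBlock ts).1.rows := by
  dsimp only [rdRBlock]; exact rdRows_int _ _

/-- v1 grammar: `rdRBlocks` reads blocks with integer rows. -/
theorem rdRBlocks_int : ∀ (n : ℕ) (ts : Toks), ∀ B ∈ (rdRBlocks n ts).1, IntRows B.rows
  | 0, ts => by simp [rdRBlocks]
  | n + 1, ts => by
    intro B hB
    simp only [rdRBlocks, List.mem_cons] at hB
    rcases hB with rfl | hB
    · exact rdRBlock_int ts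
    · exact rdRBlocks_int n _ B hB

/-- **Every R-block of a decoded v1 `gramR` text has integer rows.** -/
theorem decodeGramR_int (ts : Toks) : ∀ B ∈ decodeGramR ts, IntRows B.rows := by
  dsimp only [decodeGramR]; exact rdRBlocks_int _ _

/-! ### grammar v2 (`…DecodeV2.rdEntriesD/rdRowsD`, `…GramRDecodeV2.rdRBlockV2/rdRBlocksV2/decodeGramRV2`):
integer entries AND strictly ascending columns -/

/-- v2 grammar: every entry read by `rdEntriesD` is an integer with column `≥ nxt`. -/
theorem rdEntriesD_int_ge : ∀ (n nxt : ℕ) (ts : Toks) (e : ℚ × ℕ), e ∈ (rdEntriesD n nxt ts).1 →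
    (∃ z : ℤ, e.1 = (z : ℚ)) ∧ nxt ≤ e.2
  | 0, nxt, ts, e, he => by simp [rdEntriesD] at he
  | _ + 1, nxt, [], e, he => by simp [rdEntriesD] at he
  | _ + 1, nxt, [_], e, he => by simp [rdEntriesD] at he
  | n + 1, nxt, l :: d :: ts, e, he => by
    simp only [rdEntriesD, List.mem_cons] at he
    rcases he with rfl | he
    · exact ⟨⟨l, rfl⟩, Nat.le_add_right _ _⟩
    · have ih := rdEntriesD_int_ge n _ ts e he
      exact ⟨ih.1, by omega⟩

/-- Columns of a v2 row are STRICTLY ASCENDING (delta code). -/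
theorem rdEntriesD_sorted : ∀ (n nxt : ℕ) (ts : Toks), ((rdEntriesD n nxt ts).1).Pairwise (fun e e' => e.2 < e'.2)
  | 0, nxt, ts => by simp [rdEntriesD]
  | _ + 1, nxt, [] => by simp [rdEntriesD]
  | _ + 1, nxt, [_] => by simp [rdEntriesD]
  | n + 1, nxt, l :: d :: ts => by
    simp only [rdEntriesD]
    refine List.Pairwise.cons ?_ (rdEntriesD_sorted n _ ts)
    intro e' he'
    have h := (rdEntriesD_int_ge n _ ts e' he').2
    simp only
    omega

/-- v2 grammar: `rdRowsD` reads integer rows. -/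
theorem rdRowsD_int : ∀ (n : ℕ) (ts : Toks), IntRows (rdRowsD n ts).1
  | 0, ts => by simp [rdRowsD, IntRows]
  | n + 1, ts => by
    intro r hr
    simp only [rdRowsD, List.mem_cons] at hr
    rcases hr with rfl | hr
    · exact fun e he => (rdEntriesD_int_ge _ _ _ e he).1
    · exact rdRowsD_int n _ r hr

/-- v2 grammar: `rdRowsD` reads rows with strictly ascending columns. -/
theorem rdRowsD_sorted : ∀ (n : ℕ) (ts : Toks), ∀ r ∈ (rdRowsD n ts).1, r.Pairwise (fun e e' => e.2 < e'.2)
  | 0, ts => by simp [rdRowsD]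
  | n + 1, ts => by
    intro r hr
    simp only [rdRowsD, List.mem_cons] at hr
    rcases hr with rfl | hr
    · exact rdEntriesD_sorted _ _ _
    · exact rdRowsD_sorted n _ r hr

/-- v2 grammar: `rdRBlockV2` reads a block with integer rows. -/
theorem rdRBlockV2_int (tab : Array (ℤ × ℤ)) (ts : Toks) : IntRows (rdRBlockV2 tab ts).1.rows := by
  dsimp only [rdRBlockV2]; exact rdRowsD_int _ _

/-- v2 grammar: `rdRBlockV2` reads a block whose rows have strictly ascending columns. -/
theorem rdRBlockV2_sorted (tab : Array (ℤ × ℤ)) (ts : Toks) :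
    ∀ r ∈ (rdRBlockV2 tab ts).1.rows, r.Pairwise (fun e e' => e.2 < e'.2) := by
  dsimp only [rdRBlockV2]; exact rdRowsD_sorted _ _

/-- v2 grammar: `rdRBlocksV2` reads blocks with integer rows. -/
theorem rdRBlocksV2_int (tab : Array (ℤ × ℤ)) : ∀ (n : ℕ) (ts : Toks), ∀ B ∈ (rdRBlocksV2 tab n ts).1, IntRows B.rows
  | 0, ts => by simp [rdRBlocksV2]
  | n + 1, ts => by
    intro B hB
    simp only [rdRBlocksV2, List.mem_cons] at hB
    rcases hB with rfl | hB
    · exact rdRBlockV2_int tab ts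
    · exact rdRBlocksV2_int tab n _ B hB

/-- v2 grammar: `rdRBlocksV2` reads blocks whose rows have strictly ascending columns. -/
theorem rdRBlocksV2_sorted (tab : Array (ℤ × ℤ)) : ∀ (n : ℕ) (ts : Toks), ∀ B ∈ (rdRBlocksV2 tab n ts).1,
    ∀ r ∈ B.rows, r.Pairwise (fun e e' => e.2 < e'.2)
  | 0, ts => by simp [rdRBlocksV2]
  | n + 1, ts => by
    intro B hB
    simp only [rdRBlocksV2, List.mem_cons] at hB
    rcases hB with rfl | hB
    · exact rdRBlockV2_sorted tab ts
    · exact rdRBlocksV2_sorted tab n _ B hB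

/-- **Every R-block of a decoded v2 `gramR` text has integer rows …** -/
theorem decodeGramRV2_int (tab : Array (ℤ × ℤ)) (ts : Toks) : ∀ B ∈ decodeGramRV2 tab ts, IntRows B.rows := by
  dsimp only [decodeGramRV2]; exact rdRBlocksV2_int tab _ _

/-- **… with strictly ascending columns.** -/
theorem decodeGramRV2_sorted (tab : Array (ℤ × ℤ)) (ts : Toks) :
    ∀ B ∈ decodeGramRV2 tab ts, ∀ r ∈ B.rows, r.Pairwise (fun e e' => e.2 < e'.2) := by
  dsimp only [decodeGramRV2]; exact rdRBlocksV2_sorted tab _ _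

/-! ### `liftOKR` BY PROOF: integer rows ⇒ `rowsDen = 1`, `liftOK 1`, `liftOKR` -/

/-- The denominator `lcm` fold over an integer row does not move. -/
theorem foldl_lcm_den_eq (r : List (ℚ × ℕ)) (hr : ∀ e ∈ r, ∃ z : ℤ, e.1 = (z : ℚ)) :
    ∀ d : ℕ, r.foldl (fun d e => Nat.lcm d e.1.den) d = d := by
  induction r with
  | nil => intro d; rfl
  | cons e r ih =>
    intro d
    obtain ⟨z, hz⟩ := hr e (by simp)
    simp only [List.foldl_cons, hz, Rat.den_intCast, Nat.lcm_one_right]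
    exact ih (fun e' he' => hr e' (by simp [he'])) d

/-- Integer rows have block denominator `1`. -/
theorem rowsDen_eq_one (rows : List (List (ℚ × ℕ))) (h : IntRows rows) : rowsDen rows = 1 := by
  unfold rowsDen
  suffices hs : ∀ d : ℕ, rows.foldl (fun d r => r.foldl (fun d e => Nat.lcm d e.1.den) d) d = d from hs 1
  induction rows with
  | nil => intro d; rfl
  | cons r rows ih =>
    intro d
    simp only [List.foldl_cons, foldl_lcm_den_eq r (h r (by simp)) d]
    exact ih (fun r' hr' => h r' (by simp [hr'])) d

/-- On an integer row, `liftRow 1 ∘ rowZ 1` is the identity. -/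
theorem liftRow_rowZ_one (r : List (ℚ × ℕ)) (hr : ∀ e ∈ r, ∃ z : ℤ, e.1 = (z : ℚ)) :
    liftRow ((1 : ℕ) : ℚ) (rowZ 1 r) = r := by
  unfold liftRow rowZ
  rw [List.map_map]
  conv_rhs => rw [← List.map_id r]
  refine List.map_congr_left fun e he => ?_
  obtain ⟨z, hz⟩ := hr e he
  obtain ⟨q, k⟩ := e
  simp only at hz
  subst hz
  simp [Rat.num_intCast]

/-- Integer rows pass `liftOK 1`. -/
theorem liftOK_one (rows : List (List (ℚ × ℕ))) (h : IntRows rows) : liftOK 1 rows = true := by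
  unfold liftOK
  simp only [List.all_eq_true, decide_eq_true_eq]
  intro r hr
  exact liftRow_rowZ_one r (h r hr)

/-- **`liftOKR` holds for every R-certificate whose R-blocks have integer rows** — no `native_decide` needed. -/
theorem liftOKR_of_intRows (K : SymCertR) (h : ∀ B ∈ K.gramR, IntRows B.rows) : liftOKR K = true := by
  unfold liftOKR
  simp only [List.all_eq_true, Bool.and_eq_true, decide_eq_true_eq]
  intro B hB
  have hD : blockDen B = 1 := by unfold blockDen; exact rowsDen_eq_one _ (h B hB)
  refine ⟨by rw [hD]; exact Nat.one_pos, ?_⟩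
  rw [hD]; exact liftOK_one _ (h B hB)

/-- Any certificate whose `gramR` IS a decoded v1 R-text. -/
theorem liftOKR_of_gramR_eq_decodeGramR (K : SymCertR) (tsR : Toks) (hK : K.gramR = decodeGramR tsR) : liftOKR K = true :=
  liftOKR_of_intRows K fun B hB => decodeGramR_int tsR B (hK ▸ hB)

/-- Any certificate whose `gramR` IS a decoded v2 R-text. -/
theorem liftOKR_of_gramR_eq_decodeGramRV2 (K : SymCertR) (tab : Array (ℤ × ℤ)) (tsR : Toks)
    (hK : K.gramR = decodeGramRV2 tab tsR) : liftOKR K = true :=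
  liftOKR_of_intRows K fun B hB => decodeGramRV2_int tab tsR B (hK ▸ hB)

/-- `liftOKR` for any certificate whose R-part is a v1-decoded `gramR`. -/
theorem liftOKR_decodeGramR (K₀ : SymCert) (tsR : Toks) : liftOKR { toSymCert := K₀, gramR := decodeGramR tsR } = true :=
  liftOKR_of_intRows _ (decodeGramR_int tsR)

/-- v1 text (rung V's `decodeSymCertR`-shaped records). -/
theorem liftOKR_decodeSymCertR (ts tsR : Toks) : liftOKR (decodeSymCertR ts tsR) = true :=
  liftOKR_of_intRows _ (decodeGramR_int tsR)

/-- v2 certificate text + v1 R-text. -/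
theorem liftOKR_decodeSymCertRV2 (ts tsR : Toks) : liftOKR (decodeSymCertRV2 ts tsR) = true :=
  liftOKR_of_intRows _ (decodeGramR_int tsR)

/-- `liftOKR` for any certificate whose R-part is a v2-decoded `gramR`. -/
theorem liftOKR_decodeGramRV2 (K₀ : SymCert) (tab : Array (ℤ × ℤ)) (tsR : Toks) :
    liftOKR { toSymCert := K₀, gramR := decodeGramRV2 tab tsR } = true :=
  liftOKR_of_intRows _ (decodeGramRV2_int tab tsR)

/-- v2 certificate text + v2 R-text. -/
theorem liftOKR_decodeSymCertRV2V2 (ts tsR : Toks) : liftOKR (decodeSymCertRV2V2 ts tsR) = true := by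
  unfold decodeSymCertRV2V2; exact liftOKR_of_intRows _ (decodeGramRV2_int _ tsR)

/-! ### `denseOKR` BY PROOF: ascending columns ⇒ `colsAscLt`; `blockWidth` bounds every column of ANY block -/

/-- Pairwise strictly ascending columns (all `≥ k`, all `< N`) give `colsAscLt k · N`. -/
theorem colsAscLt_of_pairwise : ∀ (k : ℕ) (r : List (ℤ × ℕ)) (N : ℕ),
    (∀ e ∈ r, k ≤ e.2 ∧ e.2 < N) → r.Pairwise (fun a b => a.2 < b.2) → colsAscLt k r N = true
  | _, [], _, _, _ => by simp [colsAscLt]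
  | k, (a, i) :: r, N, hb, hp => by
    have hi := hb (a, i) (by simp)
    rw [List.pairwise_cons] at hp
    simp only [colsAscLt, Bool.and_eq_true, decide_eq_true_eq]
    exact ⟨⟨hi.1, hi.2⟩, colsAscLt_of_pairwise (i + 1) r N
      (fun e he => ⟨Nat.succ_le_of_lt (hp.1 e he), (hb e (by simp [he])).2⟩) hp.2⟩

/-- The max-column fold is monotone in its start value (one row). -/
theorem le_foldl_maxCol (r : List (ℚ × ℕ)) : ∀ w : ℕ, w ≤ r.foldl (fun w e => max w (e.2 + 1)) w := by
  induction r with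
  | nil => intro w; exact le_rfl
  | cons e r ih => intro w; exact le_trans (le_max_left _ _) (ih _)

/-- Every column of a row is below the row's max-column fold. -/
theorem lt_foldl_maxCol_of_mem (r : List (ℚ × ℕ)) :
    ∀ (w : ℕ) (e : ℚ × ℕ), e ∈ r → e.2 < r.foldl (fun w e => max w (e.2 + 1)) w := by
  induction r with
  | nil => intro w e he; simp at he
  | cons e' r ih =>
    intro w e he
    rw [List.foldl_cons]
    rcases List.mem_cons.mp he with rfl | he
    · exact lt_of_lt_of_le (Nat.lt_succ_self _) (le_trans (le_max_right _ _) (le_foldl_maxCol r _))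
    · exact ih _ e he

/-- The max-column fold is monotone in its start value (rows). -/
theorem le_foldl_maxColRows (rows : List (List (ℚ × ℕ))) :
    ∀ w : ℕ, w ≤ rows.foldl (fun w r => r.foldl (fun w e => max w (e.2 + 1)) w) w := by
  induction rows with
  | nil => intro w; exact le_rfl
  | cons r rows ih => intro w; exact le_trans (le_foldl_maxCol r w) (ih _)

/-- Every column of every row is below the rows' max-column fold. -/
theorem lt_foldl_maxColRows_of_mem (rows : List (List (ℚ × ℕ))) :
    ∀ (w : ℕ) (r : List (ℚ × ℕ)), r ∈ rows → ∀ e ∈ r, e.2 < rows.foldl (fun w r => r.foldl (fun w e => max w (e.2 + 1)) w) w := by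
  induction rows with
  | nil => intro w r hr; simp at hr
  | cons r' rows ih =>
    intro w r hr e he
    rw [List.foldl_cons]
    rcases List.mem_cons.mp hr with rfl | hr
    · exact lt_of_lt_of_le (lt_foldl_maxCol_of_mem r w e he) (le_foldl_maxColRows rows _)
    · exact ih _ r hr e he

/-- Every column index occurring in a block is `< blockWidth B` (any block). -/
theorem lt_blockWidth (B : GramBlockR) (r : List (ℚ × ℕ)) (hr : r ∈ B.rows) (e : ℚ × ℕ) (he : e ∈ r) :
    e.2 < blockWidth B := by
  unfold blockWidth; exact lt_foldl_maxColRows_of_mem B.rows 0 r hr e he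

/-- **`denseOKR` holds for every R-certificate whose R-rows have strictly ascending columns** (integrality not needed:
`rowZ` keeps the columns). -/
theorem denseOKR_of_sorted (K : SymCertR) (h : ∀ B ∈ K.gramR, ∀ r ∈ B.rows, r.Pairwise (fun e e' => e.2 < e'.2)) :
    denseOKR K = true := by
  unfold denseOKR
  simp only [List.all_eq_true]
  intro B hB rz hrz
  unfold blockRowsZ at hrz
  obtain ⟨r, hr, rfl⟩ := List.mem_map.mp hrz
  unfold rowOKZ
  refine colsAscLt_of_pairwise 0 _ _ (fun e he => ⟨Nat.zero_le _, ?_⟩) ?_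
  · unfold rowZ at he
    obtain ⟨e', he', rfl⟩ := List.mem_map.mp he
    exact lt_blockWidth B r hr e' he'
  · unfold rowZ
    rw [List.pairwise_map]
    exact h B hB r hr

/-- Any certificate whose `gramR` IS a decoded v2 R-text. -/
theorem denseOKR_of_gramR_eq_decodeGramRV2 (K : SymCertR) (tab : Array (ℤ × ℤ)) (tsR : Toks)
    (hK : K.gramR = decodeGramRV2 tab tsR) : denseOKR K = true :=
  denseOKR_of_sorted K fun B hB => decodeGramRV2_sorted tab tsR B (hK ▸ hB)

/-- `denseOKR` for any certificate whose R-part is a v2-decoded `gramR`. -/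
theorem denseOKR_decodeGramRV2 (K₀ : SymCert) (tab : Array (ℤ × ℤ)) (tsR : Toks) :
    denseOKR { toSymCert := K₀, gramR := decodeGramRV2 tab tsR } = true :=
  denseOKR_of_sorted _ (decodeGramRV2_sorted tab tsR)

/-- `denseOKR` for a fully v2-decoded certificate. -/
theorem denseOKR_decodeSymCertRV2V2 (ts tsR : Toks) : denseOKR (decodeSymCertRV2V2 ts tsR) = true := by
  unfold decodeSymCertRV2V2; exact denseOKR_of_sorted _ (decodeGramRV2_sorted _ tsR)

/-! ### the closing with NEITHER side fact as a hypothesis (v2 R-text) -/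

open Literature.MathematicalPhysics.QuantumLattice.ThermodynamicLimit in
/-- **CLOSING, dense integer dots, for a certificate whose `gramR` is a decoded v2 R-text**: `energyDensity_ge_of_outroutePMFD0`
with `hZ`, `hD` DISCHARGED BY PROOF (no per-certificate evaluation of `liftOKR` / `denseOKR`). -/
theorem energyDensity_ge_of_outroutePMFD0_gramRV2 {M : Type} [DecidableEq M] [Hashable M] (Sm : MomSpec M) (K : SymCertR)
    (tab : Array (ℤ × ℤ)) (tsR : Toks) (hK : K.gramR = decodeGramRV2 tab tsR) (hwf : wellFormed K.expand = true)
    (hRok : K.gramR.all (gramBlockROK K.frame) = true) (oP : PackedNF.PWord → PackedNF.PHint) (hm : MomTable M)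
    (κ₂ : Word → ℕ) (J L : ℕ) (hJ : 0 < J) (hL : 0 < L) (lo hi : ℤ × ℤ) (hbox : boxLicence K.frame lo hi = true)
    (hcov : coverM Sm K (K.gramR.map genBasis) hm = true)
    (hfacts : OutFactsP0 lo hi oP (fun m => shareRFastMFD Sm K (K.gramR.map genBasis) hm κ₂ J L (m / L) (m % L)) 0 (J * L)) :
    ((symValueR K : ℚ) : ℝ) ≤ energyDensityTT' 1 0 8 (7 / 8) :=
  energyDensity_ge_of_outroutePMFD0 Sm K hwf hRok oP hm κ₂ J L hJ hL lo hi hbox hcov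
    (liftOKR_of_gramR_eq_decodeGramRV2 K tab tsR hK) (denseOKR_of_gramR_eq_decodeGramRV2 K tab tsR hK) hfacts

end SideFacts

end Summit.Ventures.CertifiedManyBodySolver.Theorems.SymReplay
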